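import Literature.MathematicalPhysics.QuantumFieldTheory.Balaban1983to89.B9Thm312WholeHHolder
import Literature.MathematicalPhysics.QuantumFieldTheory.Balaban1983to89.B9RWSumsReadsNbr

/-!
# `Balaban1983to89.B9Thm312WholeHHolderNbr` — [B9] Theorem 3.12 (p. 423): the HÖLDER MEMBER of (3.133) for H, H₁ — ‖ζ∇H(·,y′)‖_β — at one member
# and one configuration, with the co-reading of the Hölder quantity of an H-kernel OBSERVED BY THE PROBES WITHIN DISTANCE r OF y (the Nbr
# species; the successor of `…B9Thm312WholeHHolder`'s class-sited `CoReadsHHolderRel`)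

T. Bałaban, *Propagators for lattice gauge theories in a background field*, Commun. Math. Phys. **99** (1985) 389–434
[`Balaban1985BackgroundPropagators`, "B9"]; [4] = T. Bałaban, *Propagators and renormalization transformations for lattice
gauge theories. II*, Commun. Math. Phys. **96** (1984) 223–250 [`Balaban1984PropagatorsII`].

statement-level skeleton of published theorems with citation tags; proofs where landed; nothing here is a claim about the
Yang–Mills mass gap

THE PRINTED LOCI (verbatim).  (3.133) p. 422: *"|H(x,y′)|, |(∇_UH)(x,y′)|, ‖ζ∇H(·,y′)‖_β ≦ O(1)[(Lʲη)^{−2}(L^{j′}η)^{−d}, (Lʲη)^{−3}(L^{j′}η)^{−d},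
(‖ζ‖^ξ_β + |ζ|)(Lʲη)^{−1−β}(L^{j′}η)^{−d}]e^{−(1/2)δ₁d(y,y′)} for x ∈ Δ(y), or ζ ∈ C₀^∞(Δ̃(y)), y ∈ Λ_j, y′ ∈ Λ_{j′}"*; p. 422: *"The above
inequality [(3.132)] together with Theorem 3.3 for G and the inequality (3.110) for Q give (3.133)"*; (3.126) p. 420 H = GQ*(QGQ*)⁻¹;
(3.130) p. 421; (3.40) p. 397 (the Hölder norm through ζ); p. 397 *"Δ̃(y)"*; [4] (2.51) p. 232, Lemma 2.1 (2.60) p. 234.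

WHY THIS FILE (successor of `…B9Thm312WholeHHolder`, same seat).  There the co-reading schema `CoReadsHHolderRel` reads the probes anchored IN
THE CLASS of y (`Rel (𝔭.blkPY p) y`); at the record geometry the cut-off predicate `cutInT ζ y` is the Δ̃-reading (*"every fine bond where ζ ≠ 0
lies in a block within torus distance ≤ 1 of the carrier block of y"*), so a ζ supported in a NEIGHBOURING block makes that observation blind —
n06-k's located obstruction (O2) for `H1ReadsRel`, which this schema shares.  THIS FILE re-types it ONCE in the neighbourhood-sited species of
`B9RWSumsReadsNbr.H1ReadsNbr`: the observation ranges over the probes p with d(Δ_p, y) ≦ r; the support side (ONE coarse point y′) needs no block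
equivalence at all.
* §1 ★ `CoReadsHHolderNbr` (hypothesis schema; nothing asserted), `rpow_neg_one_add_le_of_len_le` (the (Lʲη)^{−(1+β)} comparison on a
  neighbourhood), ★ `hkh_le_of_hasMajorantHom_nbr` (a probe majorant of printed shape ⇒ the Hölder line, constant CL²·e^{rδ}·B).
* §2 ★ `hkh_of_step_nbr` — the Hölder member of (3.133) for H (or H₁) at one member and one U from the letter `LettersHH.pQ`, the (3.132) letter,
  the probe step, the proved entry of H, the transfer of [4] (2.60) and the Nbr co-reading (the twin of `…HHolder.hkh_of_step`; the
  operator-level work `hkh_cNormR` is imported unchanged).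

HONEST SCOPE.  Nothing of [B9] or [4] is asserted: the letter, the step, the readings and the member facts are HYPOTHESES of printed ∕
definitional shape; the content is p. 422's one sentence carried out in the Hölder class, kernel-checked.  NOT a node discharge, NOT summit
progress; one finite lattice at a time; nothing continuum, nothing about the mass gap.  Cell `pub-ymgap` (HUMAN RULING D-0062), Track A
node N06 [B9], N06-ASSIGNMENT v1 row 20 (bundle F7), seat `pub-ymgap-dag-n06-l` (g5), 2026-08-27.
-/

namespace Literature.MathematicalPhysics.QuantumFieldTheory.Balaban1983to89.B9Thm312WholeHHolderNbr

open Literature.MathematicalPhysics.QuantumFieldTheory.Balaban1983to89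
open Finset B6RandomWalk B6RandomWalkHom B9Thm34Ext B9Thm37GlueCor36 B11SectG B9SectDSup
open B9Thm37AllNorms B9Thm37AllNormsInstances B9Thm312Whole B9Thm312WholeLeaf B9Thm312WholeLeft B9Thm312WholeH B9RWSums343Holder
open B9Ineq347 B9Thm312WholeClasses B9Thm312WholeHolder B9CoRealizesHRel B9Thm312WholeHHolder B9RWSumsReadsNbr

noncomputable section

/-! ## §1 The co-reading of the Hölder member of (3.133) through the probes within distance r of y -/

section Schema

variable {g : B9.Geometry} {B : B9.Backgrounds} {X Y PX PY : Type} [Fintype X] [Fintype Y] [Fintype PX] [Fintype PY] [Fintype g.Site]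

/-- ★ **CO-READING OF THE HÖLDER QUANTITY `Hk.h` OF AN H-KERNEL ((3.133), third member: ‖ζ∇H(·,y′)‖_β) BY A MODEL OPERATOR A = ∇_U∘H THROUGH THE
PROBES WITHIN DISTANCE r OF y** (the Nbr re-typing of `B9Thm312WholeHHolder.CoReadsHHolderRel`; the species of n06-k's `H1ReadsNbr`).  Print, (3.133)
p. 422: the kernel column H(·,y′), y′ ∈ Λ_{j′}, carries (L^{j′}η)^{−d}; the bounded quantity is ‖ζ∇H(·,y′)‖_β for ζ ∈ C₀^∞(Δ̃(y)) against
(‖ζ‖^ξ_β + |ζ|)·(…).  Typed: `obs` — for `cutInT ζ y`, `Hk.h U β ζ y′ ≦ c·(‖ζ‖^ξ_β + |ζ|)` whenever every probe p with d(Δ_p, y) ≦ r is ≦ c·(L^{j′}η)^{d}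
on A b for every test vector b supported on the fibre of the ONE coarse point y′ with |b| ≦ 1 (no block equivalence needed on either side).
A HYPOTHESIS SCHEMA on how a model instantiates `HKernel.h`; nothing asserted. [cite: Balaban1985BackgroundPropagators, (3.133) p.422 + (3.40) p.397 + p.397 (Δ̃)] -/
structure CoReadsHHolderNbr {v : Type} (Hk : B9.HKernel g B) (U : B.Cfg) (d : ℕ) (𝔭 : HolderProbes g B X Y PX PY) (r : ℝ)
    (bv : v → g.Site) (A : (v → ℝ) →ₗ[ℝ] (Y → ℝ)) : Prop where
  cutH_nonneg : ∀ (β : ℝ) (ζ : g.Cut), 0 ≤ g.cutH β ζ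
  obs : ∀ (β : ℝ) (ζ : g.Cut) (y y' : g.Site) (c : ℝ), 0 ≤ c → g.cutInT ζ y →
    (∀ b : v → ℝ, (∀ x', bv x' ≠ y' → b x' = 0) → (∀ x', |b x'| ≤ 1) →
      ∀ p : PY, g.dist (𝔭.blkPY p) y ≤ r → |𝔭.ΦY U β (A b) p| ≤ c * (g.len y') ^ (d : ℝ)) →
    Hk.h U β ζ y' ≤ c * g.cutH β ζ

omit [Fintype X] [Fintype Y] [Fintype PX] [Fintype PY] [Fintype g.Site] in
/-- comparison of the (3.133) prefactor (Lʲη)^{−(1+β)} on a neighbourhood: 0 < t ≦ CL·s, 1 ≦ CL, 0 ≦ β ≦ 1 ⇒ s^{−(1+β)} ≦ CL²·t^{−(1+β)}.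
[cite: Balaban1985BackgroundPropagators, (3.133) p.422 (the prefactor (Lʲη)^{−1−β}), bookkeeping] -/
theorem rpow_neg_one_add_le_of_len_le {s t CL β : ℝ} (ht : 0 < t) (hCL : 1 ≤ CL) (hts : t ≤ CL * s)
    (hβ0 : 0 ≤ β) (hβ1 : β ≤ 1) : s ^ (-(1 + β)) ≤ CL ^ 2 * t ^ (-(1 + β)) := by
  -- adapted from n06-k's `B9RWSumsReadsNbr.rpow_neg_le_of_len_le`
  have hCL0 : 0 < CL := zero_lt_one.trans_le hCL
  have hq : 0 < t / CL := div_pos ht hCL0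
  have hqs : t / CL ≤ s := by rw [div_le_iff₀ hCL0]; linarith [mul_comm CL s]
  calc s ^ (-(1 + β)) ≤ (t / CL) ^ (-(1 + β)) := Real.rpow_le_rpow_of_nonpos hq hqs (by linarith)
    _ = t ^ (-(1 + β)) * CL ^ (1 + β) := by
        rw [Real.div_rpow ht.le hCL0.le, Real.rpow_neg hCL0.le, div_inv_eq_mul]
    _ ≤ t ^ (-(1 + β)) * CL ^ (2 : ℝ) :=
        mul_le_mul_of_nonneg_left (Real.rpow_le_rpow_of_exponent_le hCL (by linarith)) (Real.rpow_nonneg ht.le _)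
    _ = CL ^ 2 * t ^ (-(1 + β)) := by rw [Real.rpow_two, mul_comm]

omit [Fintype X] [Fintype Y] [Fintype PX] [Fintype PY] in
/-- ★ **A PROBE MAJORANT OF THE PRINTED SHAPE + THE NEIGHBOURHOOD CO-READING ⇒ THE HÖLDER LINE OF (3.133)**: if Φ^Y_β(U)∘A has the two-space sup
majorant B·(Lʲη)^{−(1+β)}·e^{−δd(y,y′)} (B ≧ 0, 0 ≦ δ, 0 ≦ β ≦ 1) from the fibres of `bv` into the probe lattice, then for `cutInT ζ y` — every
probe within distance r of y compared with y by the level comparability CL and the shift e^{rδ} —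
`Hk.h U β ζ y′ ≦ (CL²·e^{rδ}·B)·(Lʲη)^{−(1+β)}·e^{−δd(y,y′)}·(L^{j′}η)^{−d}·(‖ζ‖^ξ_β + |ζ|)`.
[cite: Balaban1985BackgroundPropagators, (3.133) p.422 + p.397 (Δ̃); Balaban1984PropagatorsII, (2.51) p.232] -/
theorem hkh_le_of_hasMajorantHom_nbr {v : Type} [Fintype v] {Hk : B9.HKernel g B} {U : B.Cfg} {d : ℕ}
    {𝔭 : HolderProbes g B X Y PX PY} {r : ℝ} {bv : v → g.Site} {A : (v → ℝ) →ₗ[ℝ] (Y → ℝ)}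
    {R₀ : ℝ} {H₀ : Prop} (hC : CoReadsHHolderNbr Hk U d 𝔭 r bv A) (hlen : ∀ y : g.Site, 0 < g.len y)
    {CL : ℝ} (hCL1 : 1 ≤ CL) (hCL : ∀ a a' : g.Site, g.dist a a' ≤ r → g.len a ≤ CL * g.len a')
    (htri : ∀ a b c : g.Site, g.dist a c ≤ g.dist a b + g.dist b c) (hdsymm : ∀ a b : g.Site, g.dist a b = g.dist b a)
    {β Bk δ : ℝ} (hβ0 : 0 ≤ β) (hβ1 : β ≤ 1) (hBk : 0 ≤ Bk) (hδ : 0 ≤ δ)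
    (hA : HasMajorantHom (g := toB6 g R₀ H₀) bv 𝔭.blkPY (𝔭.ΦY U β ∘ₗ A)
      (fun a b => Bk * g.len a ^ (-(1 + β)) * Real.exp (-(δ * g.dist a b)))) {ζ : g.Cut} {y : g.Site} (y' : g.Site)
    (hζ : g.cutInT ζ y) :
    Hk.h U β ζ y' ≤ (CL ^ 2 * Real.exp (r * δ) * Bk) * (g.len y) ^ (-(1 + β)) * Real.exp (-(δ * g.dist y y')) *
      (g.len y') ^ (-(d : ℝ)) * g.cutH β ζ := by
  have hK0 : 0 ≤ (CL ^ 2 * Real.exp (r * δ) * Bk) * (g.len y) ^ (-(1 + β)) * Real.exp (-(δ * g.dist y y')) :=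
    mul_nonneg (mul_nonneg (mul_nonneg (mul_nonneg (sq_nonneg _) (Real.exp_nonneg _)) hBk) (Real.rpow_nonneg (hlen y).le _))
      (Real.exp_nonneg _)
  refine hC.obs β ζ y y' _ (mul_nonneg hK0 (Real.rpow_nonneg (hlen y').le _)) hζ fun b hoff hb p hp => ?_
  have hbs : BlockSupp (g := toB6 g R₀ H₀) bv b y' 1 := ⟨zero_le_one, fun x' _ => hb x', hoff⟩
  have h := hA y' b 1 hbs p
  rw [mul_one, LinearMap.comp_apply] at h
  -- the probe's block compared with y
  have hpy : g.dist y (𝔭.blkPY p) ≤ r := by rw [hdsymm]; exact hp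
  have h1 : g.len (𝔭.blkPY p) ^ (-(1 + β)) ≤ CL ^ 2 * g.len y ^ (-(1 + β)) :=
    rpow_neg_one_add_le_of_len_le (hlen y) hCL1 (hCL y (𝔭.blkPY p) hpy) hβ0 hβ1
  have h2 : Real.exp (-(δ * g.dist (𝔭.blkPY p) y')) ≤ Real.exp (r * δ) * Real.exp (-(δ * g.dist y y')) :=
    exp_shift_of_dist_le hδ htri hdsymm hp y'
  have h12 : Bk * g.len (𝔭.blkPY p) ^ (-(1 + β)) * Real.exp (-(δ * g.dist (𝔭.blkPY p) y')) ≤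
      (CL ^ 2 * Real.exp (r * δ) * Bk) * g.len y ^ (-(1 + β)) * Real.exp (-(δ * g.dist y y')) := by
    have h3 : g.len (𝔭.blkPY p) ^ (-(1 + β)) * Real.exp (-(δ * g.dist (𝔭.blkPY p) y')) ≤
        (CL ^ 2 * g.len y ^ (-(1 + β))) * (Real.exp (r * δ) * Real.exp (-(δ * g.dist y y'))) :=
      mul_le_mul h1 h2 (Real.exp_nonneg _) (mul_nonneg (sq_nonneg _) (Real.rpow_nonneg (hlen y).le _))
    calc Bk * g.len (𝔭.blkPY p) ^ (-(1 + β)) * Real.exp (-(δ * g.dist (𝔭.blkPY p) y'))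
        = Bk * (g.len (𝔭.blkPY p) ^ (-(1 + β)) * Real.exp (-(δ * g.dist (𝔭.blkPY p) y'))) := by ring
      _ ≤ Bk * ((CL ^ 2 * g.len y ^ (-(1 + β))) * (Real.exp (r * δ) * Real.exp (-(δ * g.dist y y')))) :=
          mul_le_mul_of_nonneg_left h3 hBk
      _ = (CL ^ 2 * Real.exp (r * δ) * Bk) * g.len y ^ (-(1 + β)) * Real.exp (-(δ * g.dist y y')) := by ring
  calc |𝔭.ΦY U β (A b) p| ≤ Bk * g.len (𝔭.blkPY p) ^ (-(1 + β)) * Real.exp (-(δ * g.dist (𝔭.blkPY p) y')) := h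
    _ ≤ (CL ^ 2 * Real.exp (r * δ) * Bk) * g.len y ^ (-(1 + β)) * Real.exp (-(δ * g.dist y y')) := h12
    _ = (CL ^ 2 * Real.exp (r * δ) * Bk) * g.len y ^ (-(1 + β)) * Real.exp (-(δ * g.dist y y')) * (g.len y') ^ (-(d : ℝ)) *
          (g.len y') ^ (d : ℝ) := by
        rw [mul_assoc _ ((g.len y') ^ (-(d : ℝ))), ← Real.rpow_add (hlen y'), neg_add_cancel, Real.rpow_zero, mul_one]

end Schema

/-! ## §2 One member, one U: the Hölder member of (3.133) for H = A∘Q*∘C, neighbourhood reading -/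

section OneMember

variable {g : B9.Geometry} {B : B9.Backgrounds} {X Y Z PX PY : Type}
variable [Fintype X] [Fintype Y] [Fintype Z] [Fintype PX] [Fintype PY] [Fintype g.Site]
variable {R₀ : ℝ} {H₀ : Prop}

omit [Fintype Y] [Fintype PX] in
/-- ★ **THE HÖLDER MEMBER OF (3.133) FOR H (OR H₁) AT ONE MEMBER AND ONE CONFIGURATION, PRINTED SHAPE, NEIGHBOURHOOD READING** — *"‖ζ∇H(·,y′)‖_β ≦
O(1)(‖ζ‖^ξ_β + |ζ|)(Lʲη)^{−1−β}(L^{j′}η)^{−d}e^{−(1/2)δ₁d(y,y′)}, ζ ∈ C₀^∞(Δ̃(y))"*: from `…HHolder.hkh_cNormR` (the weighted majorant of Φ^Y_β∘∇_U∘H from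
the letter `pQ`, the (3.132) letter, the probe step and the proved entry of H), the transfer of the class ratio (Lʲη∕L^{j′}η)² by [4] (2.60) at (ρ, α)
(constant Λ) and the neighbourhood co-reading `CoReadsHHolderNbr` (probes within distance r of y; level comparability CL, shift e^{r(1−α)ρ}):
`Hk.h U β ζ y′ ≦ (CL²·e^{r(1−α)ρ}·C·Λ)·(‖ζ‖^ξ_β + |ζ|)·(Lʲη)^{−(1+β)}·(L^{j′}η)^{−d}·e^{−(1−α)ρd(y,y′)}`, C = B_qB₃c + θ_HK_Hc, for 0 ≦ β ≦ 1, 0 ≦ α ≦ 1.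
[cite: Balaban1985BackgroundPropagators, (3.133) p.422 + (3.126) p.420 + (3.130) p.421 + p.398 (remark after (3.47)) + p.397 (Δ̃); Balaban1984PropagatorsII, (2.51) p.232 + (2.60) p.234] -/
theorem hkh_of_step_nbr (hG : GeoOK g) {Hk : B9.HKernel g B} {U : B.Cfg} {d : ℕ}
    (𝔭 : HolderProbes g B X Y PX PY) {r CL : ℝ} {blk : X → g.Site} {blkZ : Z → g.Site} {G0 T A : Module.End ℝ (X → ℝ)}
    {Dop : (X → ℝ) →ₗ[ℝ] (Y → ℝ)} {Qs : (Z → ℝ) →ₗ[ℝ] (X → ℝ)} {Cop : Module.End ℝ (Z → ℝ)} {Hop : (Z → ℝ) →ₗ[ℝ] (X → ℝ)}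
    {θH Bq B₃ KH β δ₃ δK ρ α Λ σ c : ℝ} (hrow : RowSum (toB6 g R₀ H₀) σ c)
    (hθH : 0 ≤ θH) (hBq : 0 ≤ Bq) (hB₃ : 0 ≤ B₃) (hKH : 0 ≤ KH) (hΛ : 0 ≤ Λ) (hσ : 0 ≤ σ) (hρ : 0 ≤ ρ) (hρ₃ : ρ + σ ≤ δ₃)
    (hρδ : ρ + σ ≤ δK) (hα1 : α ≤ 1) (hβ0 : 0 ≤ β) (hβ1 : β ≤ 1)
    (hC : CoReadsHHolderNbr Hk U d 𝔭 r blkZ (Dop ∘ₗ Hop))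
    (hCL1 : 1 ≤ CL) (hCL : ∀ a a' : g.Site, g.dist a a' ≤ r → g.len a ≤ CL * g.len a')
    (hST : ScaleTransfer g ρ α Λ (fun y => g.len y ^ (2 : ℝ)))
    (hpQ : HasMaj (cNormR R₀ H₀ blkZ hG.lenle 0) (cNormR R₀ H₀ 𝔭.blkPY hG.lenle (β - 1)) ((𝔭.ΦY U β ∘ₗ Dop ∘ₗ G0) ∘ₗ Qs)
      (fun a b => Bq * Real.exp (-(δ₃ * g.dist a b))))
    (hCop : HasMaj (cNorm R₀ H₀ blkZ hG.lenle 2) (cNorm R₀ H₀ blkZ hG.lenle 0) Cop (fun a b => B₃ * Real.exp (-(δ₃ * g.dist a b))))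
    (hpY : HasMaj (cNormR R₀ H₀ blk hG.lenle (-2)) (cNormR R₀ H₀ 𝔭.blkPY hG.lenle (β - 1)) ((𝔭.ΦY U β ∘ₗ Dop ∘ₗ G0) ∘ₗ T)
      (fun a b => θH * Real.exp (-(δK * g.dist a b))))
    (hH : HasMaj (cNorm R₀ H₀ blkZ hG.lenle 2) (cNorm R₀ H₀ blk hG.lenle 2) Hop (fun a b => KH * Real.exp (-(ρ * g.dist a b))))
    (hHop : Hop = A ∘ₗ (Qs ∘ₗ Cop)) (hfix : A = G0 + G0 ∘ₗ T ∘ₗ A) :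
    ∀ (ζ : g.Cut) (y y' : g.Site), g.cutInT ζ y →
      Hk.h U β ζ y' ≤ (CL ^ 2 * Real.exp (r * ((1 - α) * ρ)) * ((Bq * B₃ * c + θH * KH * c) * Λ)) * g.cutH β ζ *
        (g.len y) ^ (-(1 + β)) * (g.len y') ^ (-(d : ℝ)) * Real.exp (-((1 - α) * ρ * g.dist y y')) := by
  -- adapted from `B9Thm312WholeHHolder.hkh_of_step` (Nbr co-reading)
  intro ζ y y' hζ
  have hc : 0 ≤ c ∨ IsEmpty g.Site := by
    by_cases hne : Nonempty g.Site
    · exact Or.inl (hrow.nonneg hne.some)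
    · exact Or.inr (not_nonempty_iff.mp hne)
  rcases hc with hc | hemp
  swap
  · exact (hemp.false y).elim
  set K : ℝ := Bq * B₃ * c + θH * KH * c with hK
  have hK0 : 0 ≤ K := add_nonneg (mul_nonneg (mul_nonneg hBq hB₃) hc) (mul_nonneg (mul_nonneg hθH hKH) hc)
  -- the weighted majorant and its two-space form: K·(Lʲη)^{1−β}·(L^{j′}η)^{−2}·e^{−ρd}
  have hW := hkh_cNormR (E := 𝔭.ΦY U β ∘ₗ Dop) hG hrow hθH hBq hB₃ hKH hσ hρ hρ₃ hρδ hpQ hCop hpY hH hHop hfix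
  have h' := hasMajorantHom_of_hasMaj_cNormR hG (fun a b => mul_nonneg hK0 (Real.exp_nonneg _)) hW
  -- the transfer of (Lʲη ∕ L^{j′}η)²
  have hbound : ∀ a b : g.Site, K * Real.exp (-(ρ * g.dist a b)) * g.len a ^ (-(β - 1)) * g.len b ^ (-2 : ℝ) ≤
      K * Λ * g.len a ^ (-(1 + β)) * Real.exp (-((1 - α) * ρ * g.dist a b)) := by
    intro a b
    have ha : 0 < g.len a := hG.lenpos a
    have hb : 0 < g.len b := hG.lenpos b
    have ht := hST b a
    rw [hG.symm b a] at ht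
    have hsplitA : g.len a ^ (-(β - 1)) = g.len a ^ (-(1 + β)) * g.len a ^ (2 : ℝ) := by
      rw [← Real.rpow_add ha]; congr 1; ring
    have hsplit : Real.exp (-(ρ * g.dist a b)) = Real.exp (-((1 - α) * ρ * g.dist a b)) * Real.exp (-(α * ρ * g.dist a b)) := by
      rw [← Real.exp_add]; congr 1; ring
    have hratio : Real.exp (-(α * ρ * g.dist a b)) * g.len a ^ (2 : ℝ) * g.len b ^ (-2 : ℝ) ≤ Λ := by
      rw [Real.rpow_neg hb.le, ← div_eq_mul_inv, div_le_iff₀ (Real.rpow_pos_of_pos hb _)]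
      exact ht
    have hnn : 0 ≤ K * Real.exp (-((1 - α) * ρ * g.dist a b)) * g.len a ^ (-(1 + β)) :=
      mul_nonneg (mul_nonneg hK0 (Real.exp_nonneg _)) (Real.rpow_nonneg ha.le _)
    calc K * Real.exp (-(ρ * g.dist a b)) * g.len a ^ (-(β - 1)) * g.len b ^ (-2 : ℝ)
        = K * Real.exp (-((1 - α) * ρ * g.dist a b)) * g.len a ^ (-(1 + β)) *
            (Real.exp (-(α * ρ * g.dist a b)) * g.len a ^ (2 : ℝ) * g.len b ^ (-2 : ℝ)) := by rw [hsplitA, hsplit]; ring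
      _ ≤ K * Real.exp (-((1 - α) * ρ * g.dist a b)) * g.len a ^ (-(1 + β)) * Λ := mul_le_mul_of_nonneg_left hratio hnn
      _ = K * Λ * g.len a ^ (-(1 + β)) * Real.exp (-((1 - α) * ρ * g.dist a b)) := by ring
  have hA := hasMajorantHom_mono (g := toB6 g R₀ H₀) blkZ 𝔭.blkPY h' hbound
  have hA' : HasMajorantHom (g := toB6 g R₀ H₀) blkZ 𝔭.blkPY (𝔭.ΦY U β ∘ₗ (Dop ∘ₗ Hop))
      (fun a b => K * Λ * g.len a ^ (-(1 + β)) * Real.exp (-((1 - α) * ρ * g.dist a b))) := hA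
  have hδ : 0 ≤ (1 - α) * ρ := mul_nonneg (by linarith) hρ
  have h := hkh_le_of_hasMajorantHom_nbr (R₀ := R₀) (H₀ := H₀) hC hG.lenpos hCL1 hCL hG.tri hG.symm hβ0 hβ1 (mul_nonneg hK0 hΛ) hδ
    hA' y' hζ
  calc Hk.h U β ζ y' ≤ (CL ^ 2 * Real.exp (r * ((1 - α) * ρ)) * (K * Λ)) * g.len y ^ (-(1 + β)) *
        Real.exp (-((1 - α) * ρ * g.dist y y')) * (g.len y') ^ (-(d : ℝ)) * g.cutH β ζ := h
    _ = (CL ^ 2 * Real.exp (r * ((1 - α) * ρ)) * (K * Λ)) * g.cutH β ζ * (g.len y) ^ (-(1 + β)) * (g.len y') ^ (-(d : ℝ)) *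
        Real.exp (-((1 - α) * ρ * g.dist y y')) := by ring

end OneMember

end

end Literature.MathematicalPhysics.QuantumFieldTheory.Balaban1983to89.B9Thm312WholeHHolderNbr
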